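import Literature.NumberTheory.QuadraticFields.Sqrt73Places
import Literature.Barriers.BirchSwinnertonDyer.RankNotSumOfLocalInvariantsK41Data
import HarnessLib

/-!
# `rk E(F₄)` for `E = 480a1`: the `2`-descent over `ℚ(√73)`, I — the group `K(S, 2)` in coordinates

Data for the complete `2`-descent of `E = 480a1 : y² = x(x + 2)(x - 3)` over `K = ℚ(√73)`
(T. Dokchitser–V. Dokchitser, *A note on the Mordell–Weil rank modulo n*, J. Number Theory 131
(2011), proof of Thm. 2: "2-descent … over all minimal non-trivial subfields of `F₄`"), with
`S = {∞⁺, ∞⁻, 𝔭₂, 𝔭₂', 𝔭₃, 𝔭₃', (5)}` the places of `K` above `∞, 2, 3, 5`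
(`Literature/NumberTheory/QuadraticFields/Sqrt73*.lean`: `h_K = 1`, units `±ε^ℤ`, `N ε = -1`);
the companion of `RankNotSumOfLocalInvariantsK41Data.lean` (`K = ℚ(√41)`), whose field-independent
helpers are reused.

* The seven **structural bits** of `z ∈ Kˣ` (`Bits z ∈ 𝔽₂⁷`): the signs `s⁺, s⁻` at the real
  embeddings, the parities `a⁺, a⁻` of `v₂ ∘ ι±`, `a₅` of `ord_(5) = v₅ ∘ N / 2`, `c⁺, c⁻` of
  `v₃ ∘ κ±`; each is additive on products (`Bits_mul`).
* The basis `-1, ε = 1068 + 125√73, π₂ = (9 + √73)/2, 2, 3, π₃ = 17 + 2√73, 5` of `K(S, 2)`, its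
  bit table (`Bits_values`), from the expansions `√73 = 29 + 64t ∈ ℤ₂`, `√73 = 1 + 9t' ∈ ℤ₃`, the
  character sum (`char_eq_sum`) and the values of the seven non-structural local characters
  `c4±, c8±` (dyadic), `x₅` (inert), `q± = (·/3) ∘ κ±` on the basis (`Row_values`, `Row_eq`).

Everything is proved (definitions + theorems, no named facts).

## References

* T. Dokchitser, V. Dokchitser, *A note on the Mordell–Weil rank modulo n*, J. Number Theory 131
  (2011) 1833–1839, proof of Thm. 2. [DokchitserDokchitser2011RankModN]
* J. H. Silverman, *The Arithmetic of Elliptic Curves*, 2nd ed. (2009), Prop. VIII.1.6, X.1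
  (the group `K(S, 2)`), Example X.1.5. [SilvermanAEC2009]
-/

noncomputable section

open NumberField QuadraticAlgebra IsDedekindDomain IsDedekindDomain.HeightOneSpectrum WithZero
open WeierstrassCurve.Affine
open Literature.NumberTheory.QuadraticFields.Sqrt73
open Literature.NumberTheory.QuadraticFields.Sqrt41 (valuation_two' valuation_neg'')
open Literature.NumberTheory.NumberFields
open Literature.NumberTheory.EllipticCurves.TwoDescentLocal
open Literature.NumberTheory.EllipticCurves.KramerTwoDescent

namespace Literature.Barriers.BirchSwinnertonDyer

namespace DokchitserDokchitser2011

open K41D (norm_intCast_eq_one norm_intCast_lt_one norm_intCast_add_mul valuation_intCast_add_mul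
  presPow_eq_of_norm_eq_one pres_eq_of_norm_eq_one presPow_intCast_add_mul pres_intCast_add_mul V7
  pc48_intCast_add_mul)

namespace K73D

/-! ### The places of `K` above `2, 3, 5` as abstract odd places; the structural bits -/

/-- `v₅(73) = 0` and `73 ≡ 3` is a non-square mod `5`: `5` is inert in `K`. [folklore] -/
theorem inert_five_data : padicValRat 5 (73 : ℚ) = 0 ∧ ¬ IsSquare (res 5 (73 : ℚ)) := by
  refine ⟨?_, ?_⟩
  · rw [show (73 : ℚ) = ((73 : ℕ) : ℚ) by norm_num, padicValRat.of_nat]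
    simp [padicValNat.eq_zero_of_not_dvd (show ¬ 5 ∣ 73 by norm_num)]
  · rw [res_five_values.2.2.2.2.2]
    exact isSquare_values.2.2.1

/-- The inert place `(5)` of `K`. [folklore] -/
def 𝔳5 : OddPlace K := inertPlace 5 73 inert_five_data.1 inert_five_data.2

/-- The sign bit at `σ⁺`. [folklore] -/
def sP (z : K) : ZMod 2 := rsign (σpos z)
/-- The sign bit at `σ⁻`. [folklore] -/
def sN (z : K) : ZMod 2 := rsign (σneg z)
/-- The parity of `v₂ ∘ ι⁺`. [folklore] -/
def aP (z : K) : ZMod 2 := ((ιpos z).valuation : ZMod 2)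
/-- The parity of `v₂ ∘ ι⁻`. [folklore] -/
def aN (z : K) : ZMod 2 := ((ιneg z).valuation : ZMod 2)
/-- The parity of `ord_(5) = v₅ ∘ N / 2`. [folklore] -/
def a5 (z : K) : ZMod 2 := 𝔳5.parity z
/-- The parity of `v₃ ∘ κ⁺`. [folklore] -/
def cP (z : K) : ZMod 2 := ((κpos z).valuation : ZMod 2)
/-- The parity of `v₃ ∘ κ⁻`. [folklore] -/
def cN (z : K) : ZMod 2 := ((κneg z).valuation : ZMod 2)

/-- **The structural bits** `(s⁺, s⁻, a⁺, a⁻, a₅, c⁺, c⁻)` of `z ∈ K`. [folklore] -/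
def Bits (z : K) : V7 := (sP z, sN z, aP z, aN z, a5 z, cP z, cN z)

/-- Unfolding `a5`: the parity of `v₅(N z)/2`. [folklore] -/
theorem a5_eq (z : K) : a5 z = ((padicValRat 5 z.norm / 2 : ℤ) : ZMod 2) := rfl

/-- The sign bits are additive on products. [folklore] -/
theorem sP_mul {z w : K} (hz : z ≠ 0) (hw : w ≠ 0) : sP (z * w) = sP z + sP w := by
  rw [sP, sP, sP, map_mul, rsign_mul ((map_ne_zero σpos).mpr hz) ((map_ne_zero σpos).mpr hw)]

/-- The sign bits are additive on products. [folklore] -/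
theorem sN_mul {z w : K} (hz : z ≠ 0) (hw : w ≠ 0) : sN (z * w) = sN z + sN w := by
  rw [sN, sN, sN, map_mul, rsign_mul ((map_ne_zero σneg).mpr hz) ((map_ne_zero σneg).mpr hw)]

/-- `a⁺` is additive on products. [folklore] -/
theorem aP_mul {z w : K} (hz : z ≠ 0) (hw : w ≠ 0) : aP (z * w) = aP z + aP w := by
  rw [aP, aP, aP, map_mul, Padic.valuation_mul ((map_ne_zero ιpos).mpr hz) ((map_ne_zero ιpos).mpr hw),
    Int.cast_add]

/-- `a⁻` is additive on products. [folklore] -/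
theorem aN_mul {z w : K} (hz : z ≠ 0) (hw : w ≠ 0) : aN (z * w) = aN z + aN w := by
  rw [aN, aN, aN, map_mul, Padic.valuation_mul ((map_ne_zero ιneg).mpr hz) ((map_ne_zero ιneg).mpr hw),
    Int.cast_add]

/-- `a₅` is additive on products. [folklore] -/
theorem a5_mul {z w : K} (hz : z ≠ 0) (hw : w ≠ 0) : a5 (z * w) = a5 z + a5 w :=
  𝔳5.parity_mul hz hw

/-- `c⁺` is additive on products. [folklore] -/
theorem cP_mul {z w : K} (hz : z ≠ 0) (hw : w ≠ 0) : cP (z * w) = cP z + cP w := by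
  rw [cP, cP, cP, map_mul, Padic.valuation_mul ((map_ne_zero κpos).mpr hz) ((map_ne_zero κpos).mpr hw),
    Int.cast_add]

/-- `c⁻` is additive on products. [folklore] -/
theorem cN_mul {z w : K} (hz : z ≠ 0) (hw : w ≠ 0) : cN (z * w) = cN z + cN w := by
  rw [cN, cN, cN, map_mul, Padic.valuation_mul ((map_ne_zero κneg).mpr hz) ((map_ne_zero κneg).mpr hw),
    Int.cast_add]

/-- **The structural bits are additive on products.** [folklore] -/
theorem Bits_mul {z w : K} (hz : z ≠ 0) (hw : w ≠ 0) : Bits (z * w) = Bits z + Bits w := by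
  simp only [Bits, sP_mul hz hw, sN_mul hz hw, aP_mul hz hw, aN_mul hz hw, a5_mul hz hw, cP_mul hz hw,
    cN_mul hz hw, Prod.mk_add_mk]

/-- The bits of `1` vanish. [folklore] -/
theorem Bits_one : Bits (1 : K) = 0 := by
  have h := Bits_mul (one_ne_zero (α := K)) one_ne_zero
  rw [mul_one] at h
  have : Bits (1 : K) + Bits 1 - Bits 1 = Bits 1 - Bits 1 := by rw [← h]
  simpa using this

/-! ### The basis of `K(S, 2)` -/

/-- `ε = 1068 + 125√73` in `K`. [folklore] -/
def εK : K := ⟨1068, 125⟩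
/-- `π₂ = (9 + √73)/2` in `K`. [folklore] -/
def π₂K : K := ⟨9 / 2, 1 / 2⟩
/-- `π₃ = 17 + 2√73` in `K`. [folklore] -/
def π₃K : K := ⟨17, 2⟩

/-- `εK` is the unit `ε` of `𝓞 K`. [folklore] -/
theorem εK_eq : εK = (((unitEps : (𝓞 K)ˣ) : 𝓞 K) : K) := coe_unitEps.symm

/-- `π₂K` is `π₂ ∈ 𝓞 K`. [folklore] -/
theorem π₂K_eq : π₂K = ((π₂ : 𝓞 K) : K) := by
  rw [coe_π₂, π₂K]
  ext
  · simp [φ]; norm_num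
  · simp [φ]

/-- `π₃K` is `π₃ ∈ 𝓞 K`. [folklore] -/
theorem π₃K_eq : π₃K = ((π₃ : 𝓞 K) : K) := by
  rw [coe_π₃_θ, π₃K]; ext <;> simp [θ]

/-- The basis elements are non-zero. [folklore] -/
theorem gens_ne_zero : (-1 : K) ≠ 0 ∧ εK ≠ 0 ∧ π₂K ≠ 0 ∧ (2 : K) ≠ 0 ∧ (3 : K) ≠ 0 ∧ π₃K ≠ 0 ∧
    (5 : K) ≠ 0 := by
  refine ⟨by norm_num, ?_, ?_, by norm_num, by norm_num, ?_, by norm_num⟩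
  · intro h; have := congrArg QuadraticAlgebra.im h; simp [εK] at this
  · intro h; have := congrArg QuadraticAlgebra.im h; simp [π₂K] at this
  · intro h; have := congrArg QuadraticAlgebra.im h; simp [π₃K] at this

/-! ### Values of the embeddings on the basis -/

section Expansions

/-- `ι⁺ ε = 4693 + 8000 t`, `ι⁻ ε = -2557 - 8000 t`, `ι⁺ π₂ = 19 + 32 t`, `ι⁻ π₂ = 2 (-5 - 16 t)`,
`ι⁺ π₃ = 75 + 128 t`, `ι⁻ π₃ = -41 - 128 t` for `√73 = 29 + 64 t` in `ℤ₂`. [folklore] -/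
theorem ι_values {t : ℤ_[2]} (ht : sqrt73Two = 29 + 2 ^ 6 * t) :
    ιpos εK = ((4693 : ℤ) : ℚ_[2]) + ((8000 : ℤ) : ℚ_[2]) * (t : ℚ_[2]) ∧
    ιneg εK = ((-2557 : ℤ) : ℚ_[2]) + ((-8000 : ℤ) : ℚ_[2]) * (t : ℚ_[2]) ∧
    ιpos π₂K = ((19 : ℤ) : ℚ_[2]) + ((32 : ℤ) : ℚ_[2]) * (t : ℚ_[2]) ∧
    ιneg π₂K = 2 * (((-5 : ℤ) : ℚ_[2]) + ((-16 : ℤ) : ℚ_[2]) * (t : ℚ_[2])) ∧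
    ιpos π₃K = ((75 : ℤ) : ℚ_[2]) + ((128 : ℤ) : ℚ_[2]) * (t : ℚ_[2]) ∧
    ιneg π₃K = ((-41 : ℤ) : ℚ_[2]) + ((-128 : ℤ) : ℚ_[2]) * (t : ℚ_[2]) := by
  have hr := coe_sqrt73Two_eq ht
  refine ⟨?_, ?_, ?_, ?_, ?_, ?_⟩ <;>
    simp only [ιpos_apply, ιneg_apply, εK, π₂K, π₃K, hr] <;> push_cast <;> ring

/-- `κ⁺ ε = 1193 + 1125 t`, `κ⁻ ε = 943 - 1125 t`, `κ⁺ π₂ = 2⁻¹ (10 + 9 t)`,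
`κ⁻ π₂ = 2⁻¹ (8 - 9 t)`, `κ⁺ π₃ = 19 + 18 t`, `κ⁻ π₃ = 3 (5 - 6t)` for `√73 = 1 + 9 t` in `ℤ₃`.
[folklore] -/
theorem κ_values {t : ℤ_[3]} (ht : sqrt73Three = 1 + 3 ^ 2 * t) :
    κpos εK = ((1193 : ℤ) : ℚ_[3]) + ((1125 : ℤ) : ℚ_[3]) * (t : ℚ_[3]) ∧
    κneg εK = ((943 : ℤ) : ℚ_[3]) + ((-1125 : ℤ) : ℚ_[3]) * (t : ℚ_[3]) ∧
    κpos π₂K = 2⁻¹ * (((10 : ℤ) : ℚ_[3]) + ((9 : ℤ) : ℚ_[3]) * (t : ℚ_[3])) ∧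
    κneg π₂K = 2⁻¹ * (((8 : ℤ) : ℚ_[3]) + ((-9 : ℤ) : ℚ_[3]) * (t : ℚ_[3])) ∧
    κpos π₃K = ((19 : ℤ) : ℚ_[3]) + ((18 : ℤ) : ℚ_[3]) * (t : ℚ_[3]) ∧
    κneg π₃K = 3 * (((5 : ℤ) : ℚ_[3]) + ((-6 : ℤ) : ℚ_[3]) * (t : ℚ_[3])) := by
  have hr := coe_sqrt73Three_eq ht
  refine ⟨?_, ?_, ?_, ?_, ?_, ?_⟩ <;>
    simp only [κpos_apply, κneg_apply, εK, π₂K, π₃K, hr] <;> push_cast <;> ring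

end Expansions

/-! ### The bit table of the basis -/

/-- `17 < 2√73`. [folklore] -/
theorem seventeen_lt : (17 : ℝ) < 2 * Real.sqrt 73 := by
  have : (17 / 2 : ℝ) < Real.sqrt 73 := by rw [Real.lt_sqrt (by norm_num)]; norm_num
  linarith

/-- Signs of the basis elements: only `-1` (both), `ε` (at `σ⁻`) and `π₃` (at `σ⁻`) are
negative. [folklore] -/
theorem signs_values :
    (sP (-1 : K) = 1 ∧ sN (-1 : K) = 1) ∧ (sP εK = 0 ∧ sN εK = 1) ∧ (sP π₂K = 0 ∧ sN π₂K = 0) ∧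
    (sP π₃K = 0 ∧ sN π₃K = 1) ∧
    (∀ n : ℕ, sP (n : K) = 0 ∧ sN (n : K) = 0) := by
  obtain ⟨h8, h9, h1068⟩ := sqrt73_bounds
  have h17 := seventeen_lt
  have pos : ∀ {x : ℝ}, 0 < x → rsign x = 0 := fun hx => by rw [rsign, if_neg (not_lt.mpr hx.le)]
  have neg : ∀ {x : ℝ}, x < 0 → rsign x = 1 := fun hx => by rw [rsign, if_pos hx]
  refine ⟨⟨?_, ?_⟩, ⟨?_, ?_⟩, ⟨?_, ?_⟩, ⟨?_, ?_⟩, fun n => ⟨?_, ?_⟩⟩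
  · rw [sP, map_neg, map_one]; exact neg (by norm_num)
  · rw [sN, map_neg, map_one]; exact neg (by norm_num)
  · rw [sP, σpos_apply]; simp only [εK]; push_cast; exact pos (by positivity)
  · rw [sN, σneg_apply]; simp only [εK]; push_cast; exact neg (by linarith)
  · rw [sP, σpos_apply]; simp only [π₂K]; push_cast; exact pos (by positivity)
  · rw [sN, σneg_apply]; simp only [π₂K]; push_cast; exact pos (by linarith)
  · rw [sP, σpos_apply]; simp only [π₃K]; push_cast; exact pos (by positivity)
  · rw [sN, σneg_apply]; simp only [π₃K]; push_cast; exact neg (by linarith)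
  · rw [sP, map_natCast, rsign, if_neg (not_lt.mpr (Nat.cast_nonneg n))]
  · rw [sN, map_natCast, rsign, if_neg (not_lt.mpr (Nat.cast_nonneg n))]

/-- `2`-adic parities of the basis elements: `a⁺ = 1` exactly for `2`; `a⁻ = 1` exactly for
`π₂, 2`. [folklore] -/
theorem a_values :
    (aP (-1 : K) = 0 ∧ aN (-1 : K) = 0) ∧ (aP εK = 0 ∧ aN εK = 0) ∧ (aP π₂K = 0 ∧ aN π₂K = 1) ∧
    (aP (2 : K) = 1 ∧ aN (2 : K) = 1) ∧ (aP (3 : K) = 0 ∧ aN (3 : K) = 0) ∧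
    (aP π₃K = 0 ∧ aN π₃K = 0) ∧ (aP (5 : K) = 0 ∧ aN (5 : K) = 0) := by
  obtain ⟨t, ht⟩ := exists_sqrt73Two_eq
  obtain ⟨e1, e2, e3, e4, e5, e6⟩ := ι_values ht
  have hu : ∀ {n m : ℤ}, ¬ (2 : ℤ) ∣ n → (2 : ℤ) ∣ m →
      ((((n : ℚ_[2]) + (m : ℚ_[2]) * (t : ℚ_[2])).valuation : ℤ) : ZMod 2) = 0 := by
    intro n m hn hm; rw [(valuation_intCast_add_mul hn hm t).2, Int.cast_zero]
  have hint : ∀ (τ : K →ₐ[ℚ] ℚ_[2]) {n : ℤ}, ¬ (2 : ℤ) ∣ n → (((τ (n : K)).valuation : ℤ) : ZMod 2) = 0 := by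
    intro τ n hn
    rw [map_intCast, show ((n : ℚ_[2])) = ((n : ℚ) : ℚ_[2]) by push_cast; rfl, Padic.valuation_ratCast,
      padicValRat.of_int, padicValInt.eq_zero_of_not_dvd hn]; rfl
  refine ⟨⟨?_, ?_⟩, ⟨?_, ?_⟩, ⟨?_, ?_⟩, ⟨?_, ?_⟩, ⟨?_, ?_⟩, ⟨?_, ?_⟩, ⟨?_, ?_⟩⟩
  · rw [aP, show (-1 : K) = ((-1 : ℤ) : K) by norm_num]; exact hint ιpos (by decide)
  · rw [aN, show (-1 : K) = ((-1 : ℤ) : K) by norm_num]; exact hint ιneg (by decide)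
  · rw [aP, e1]; exact hu (by decide) (by decide)
  · rw [aN, e2]; exact hu (by decide) (by decide)
  · rw [aP, e3]; exact hu (by decide) (by decide)
  · rw [aN, π₂K_eq, valuation_ιneg_π₂]; rfl
  · rw [aP, map_ofNat, valuation_two']; rfl
  · rw [aN, map_ofNat, valuation_two']; rfl
  · rw [aP, show (3 : K) = ((3 : ℤ) : K) by norm_num]; exact hint ιpos (by decide)
  · rw [aN, show (3 : K) = ((3 : ℤ) : K) by norm_num]; exact hint ιneg (by decide)
  · rw [aP, e5]; exact hu (by decide) (by decide)
  · rw [aN, e6]; exact hu (by decide) (by decide)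
  · rw [aP, show (5 : K) = ((5 : ℤ) : K) by norm_num]; exact hint ιpos (by decide)
  · rw [aN, show (5 : K) = ((5 : ℤ) : K) by norm_num]; exact hint ιneg (by decide)

/-- `3`-adic parities of the basis elements: `c⁺ = 1` exactly for `3`; `c⁻ = 1` exactly for
`3, π₃`. [folklore] -/
theorem c_values :
    (cP (-1 : K) = 0 ∧ cN (-1 : K) = 0) ∧ (cP εK = 0 ∧ cN εK = 0) ∧ (cP π₂K = 0 ∧ cN π₂K = 0) ∧
    (cP (2 : K) = 0 ∧ cN (2 : K) = 0) ∧ (cP (3 : K) = 1 ∧ cN (3 : K) = 1) ∧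
    (cP π₃K = 0 ∧ cN π₃K = 1) ∧ (cP (5 : K) = 0 ∧ cN (5 : K) = 0) := by
  obtain ⟨t, ht⟩ := exists_sqrt73Three_eq
  obtain ⟨e1, e2, e3, e4, e5, e6⟩ := κ_values ht
  have hu : ∀ {n m : ℤ}, ¬ (3 : ℤ) ∣ n → (3 : ℤ) ∣ m →
      ((((n : ℚ_[3]) + (m : ℚ_[3]) * (t : ℚ_[3])).valuation : ℤ) : ZMod 2) = 0 := by
    intro n m hn hm; rw [(valuation_intCast_add_mul hn hm t).2, Int.cast_zero]
  have hint : ∀ (τ : K →ₐ[ℚ] ℚ_[3]) {n : ℤ}, ¬ (3 : ℤ) ∣ n → (((τ (n : K)).valuation : ℤ) : ZMod 2) = 0 := by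
    intro τ n hn
    rw [map_intCast, show ((n : ℚ_[3])) = ((n : ℚ) : ℚ_[3]) by push_cast; rfl, Padic.valuation_ratCast,
      padicValRat.of_int, padicValInt.eq_zero_of_not_dvd hn]; rfl
  have h2 : (2 : ℚ_[3])⁻¹.valuation = 0 := by
    rw [Padic.valuation_inv, show (2 : ℚ_[3]) = ((2 : ℚ) : ℚ_[3]) by norm_num, Padic.valuation_ratCast,
      show (2 : ℚ) = ((2 : ℤ) : ℚ) by norm_num, padicValRat.of_int,
      padicValInt.eq_zero_of_not_dvd (by decide)]; rfl
  have hhalf : ∀ {n m : ℤ}, ¬ (3 : ℤ) ∣ n → (3 : ℤ) ∣ m →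
      ((((2 : ℚ_[3])⁻¹ * ((n : ℚ_[3]) + (m : ℚ_[3]) * (t : ℚ_[3]))).valuation : ℤ) : ZMod 2) = 0 := by
    intro n m hn hm
    obtain ⟨hne, hv⟩ := valuation_intCast_add_mul hn hm t
    rw [Padic.valuation_mul (inv_ne_zero (by norm_num)) hne, h2, hv]; rfl
  have hv3 : (3 : ℚ_[3]).valuation = 1 := valuation_three'
  refine ⟨⟨?_, ?_⟩, ⟨?_, ?_⟩, ⟨?_, ?_⟩, ⟨?_, ?_⟩, ⟨?_, ?_⟩, ⟨?_, ?_⟩, ⟨?_, ?_⟩⟩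
  · rw [cP, show (-1 : K) = ((-1 : ℤ) : K) by norm_num]; exact hint κpos (by decide)
  · rw [cN, show (-1 : K) = ((-1 : ℤ) : K) by norm_num]; exact hint κneg (by decide)
  · rw [cP, e1]; exact hu (by decide) (by decide)
  · rw [cN, e2]; exact hu (by decide) (by decide)
  · rw [cP, e3]; exact hhalf (by decide) (by decide)
  · rw [cN, e4]; exact hhalf (by decide) (by decide)
  · rw [cP, show (2 : K) = ((2 : ℤ) : K) by norm_num]; exact hint κpos (by decide)
  · rw [cN, show (2 : K) = ((2 : ℤ) : K) by norm_num]; exact hint κneg (by decide)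
  · rw [cP, map_ofNat, hv3]; rfl
  · rw [cN, map_ofNat, hv3]; rfl
  · rw [cP, e5]; exact hu (by decide) (by decide)
  · rw [cN, π₃K_eq, valuation_κneg_π₃]; rfl
  · rw [cP, show (5 : K) = ((5 : ℤ) : K) by norm_num]; exact hint κpos (by decide)
  · rw [cN, show (5 : K) = ((5 : ℤ) : K) by norm_num]; exact hint κneg (by decide)

/-- Norms of the basis elements. [folklore] -/
theorem norm_values : (-1 : K).norm = 1 ∧ εK.norm = -1 ∧ π₂K.norm = 2 ∧ (2 : K).norm = 4 ∧
    (3 : K).norm = 9 ∧ π₃K.norm = -3 ∧ (5 : K).norm = 25 := by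
  simp only [norm_def, εK, π₂K, π₃K]
  norm_num [re_ofNat, im_ofNat]

/-- `5`-parities of the basis elements: only `5` has `a₅ = 1`. [folklore] -/
theorem a5_values : a5 (-1 : K) = 0 ∧ a5 εK = 0 ∧ a5 π₂K = 0 ∧ a5 (2 : K) = 0 ∧ a5 (3 : K) = 0 ∧
    a5 π₃K = 0 ∧ a5 (5 : K) = 1 := by
  obtain ⟨n1, n2, n3, n4, n5, n6, n7⟩ := norm_values
  have hv : ∀ {q : ℤ}, ¬ (5 : ℤ) ∣ q → padicValRat 5 (q : ℚ) = 0 := fun hq => by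
    rw [padicValRat.of_int, padicValInt.eq_zero_of_not_dvd hq]; rfl
  simp only [a5_eq, n1, n2, n3, n4, n5, n6, n7]
  refine ⟨?_, ?_, ?_, ?_, ?_, ?_, ?_⟩
  · rw [padicValRat.one]; rfl
  · rw [show (-1 : ℚ) = ((-1 : ℤ) : ℚ) by norm_num, hv (by decide)]; rfl
  · rw [show (2 : ℚ) = ((2 : ℤ) : ℚ) by norm_num, hv (by decide)]; rfl
  · rw [show (4 : ℚ) = ((4 : ℤ) : ℚ) by norm_num, hv (by decide)]; rfl
  · rw [show (9 : ℚ) = ((9 : ℤ) : ℚ) by norm_num, hv (by decide)]; rfl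
  · rw [show (-3 : ℚ) = ((-3 : ℤ) : ℚ) by norm_num, hv (by decide)]; rfl
  · rw [show (25 : ℚ) = ((5 : ℕ) : ℚ) ^ 2 by norm_num, padicValRat.pow, padicValRat.self (by norm_num)]; rfl

/-- **The bit table of the basis `-1, ε, π₂, 2, 3, π₃, 5` of `K(S, 2)`.** [folklore] -/
theorem Bits_values :
    Bits (-1 : K) = (1, 1, 0, 0, 0, 0, 0) ∧ Bits εK = (0, 1, 0, 0, 0, 0, 0) ∧
    Bits π₂K = (0, 0, 0, 1, 0, 0, 0) ∧ Bits (2 : K) = (0, 0, 1, 1, 0, 0, 0) ∧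
    Bits (3 : K) = (0, 0, 0, 0, 0, 1, 1) ∧ Bits π₃K = (0, 1, 0, 0, 0, 0, 1) ∧
    Bits (5 : K) = (0, 0, 0, 0, 1, 0, 0) := by
  obtain ⟨⟨s1, s1'⟩, ⟨s2, s2'⟩, ⟨s3, s3'⟩, ⟨s6, s6'⟩, sn⟩ := signs_values
  obtain ⟨⟨a1, a1'⟩, ⟨a2, a2'⟩, ⟨a3', a3''⟩, ⟨a4, a4'⟩, ⟨a5', a5''⟩, ⟨a6, a6'⟩, ⟨a7, a7'⟩⟩ := a_values
  obtain ⟨⟨b1, b1'⟩, ⟨b2, b2'⟩, ⟨b3, b3'⟩, ⟨b4, b4'⟩, ⟨b5, b5'⟩, ⟨b6, b6'⟩, ⟨b7, b7'⟩⟩ := c_values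
  obtain ⟨c1, c2, c3, c4, c5, c6, c7⟩ := a5_values
  obtain ⟨s4, s4'⟩ := sn 2
  obtain ⟨s5, s5'⟩ := sn 3
  obtain ⟨s7, s7'⟩ := sn 5
  simp only [Nat.cast_ofNat] at s4 s4' s5 s5' s7 s7'
  simp only [Bits, s1, s1', s2, s2', s3, s3', s4, s4', s5, s5', s6, s6', s7, s7', a1, a1', a2, a2', a3',
    a3'', a4, a4', a5', a5'', a6, a6', a7, a7', b1, b1', b2, b2', b3, b3', b4, b4', b5, b5', b6, b6', b7,
    b7', c1, c2, c3, c4, c5, c6, c7, and_self]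

/-! ### The correction factor `∏ gⱼ^{nⱼ}` and the character sum -/

/-- A generator raised to a bit: `g^e` for `e ∈ ℤ/2` (`1` or `g`). [folklore] -/
def pw (g : K) (e : ZMod 2) : K := if e = 0 then 1 else g

/-- `pw g e ≠ 0`. [folklore] -/
theorem pw_ne_zero {g : K} (hg : g ≠ 0) (e : ZMod 2) : pw g e ≠ 0 := by
  unfold pw; split_ifs
  · exact one_ne_zero
  · exact hg

/-- The bits of `pw g e` are `e • Bits g`. [folklore] -/
theorem Bits_pw (g : K) (e : ZMod 2) : Bits (pw g e) = e • Bits g := by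
  unfold pw
  rcases (show e = 0 ∨ e = 1 by revert e; decide) with rfl | rfl
  · rw [if_pos rfl, zero_smul, Bits_one]
  · rw [if_neg (by decide), one_smul]

/-- **The exponents** of a class on the basis `-1, ε, π₂, 2, 3, π₃, 5` in terms of its bits
`B = (s⁺, s⁻, a⁺, a⁻, a₅, c⁺, c⁻)`:
`(s⁺, s⁺ + s⁻ + c⁺ + c⁻, a⁺ + a⁻, a⁺, c⁺, c⁺ + c⁻, a₅)` (the inverse of the bit table).
[folklore] -/
def ex (B : V7) : V7 :=
  (B.1, B.1 + B.2.1 + B.2.2.2.2.2.1 + B.2.2.2.2.2.2, B.2.2.1 + B.2.2.2.1, B.2.2.1, B.2.2.2.2.2.1,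
    B.2.2.2.2.2.1 + B.2.2.2.2.2.2, B.2.2.2.2.1)

/-- **The correction factor** `(-1)^{n₁} ε^{n₂} π₂^{n₃} 2^{n₄} 3^{n₅} π₃^{n₆} 5^{n₇}`. [folklore] -/
def corr (B : V7) : K :=
  pw (-1) (ex B).1 * pw εK (ex B).2.1 * pw π₂K (ex B).2.2.1 * pw 2 (ex B).2.2.2.1 *
    pw 3 (ex B).2.2.2.2.1 * pw π₃K (ex B).2.2.2.2.2.1 * pw 5 (ex B).2.2.2.2.2.2

/-- `corr B ≠ 0`. [folklore] -/
theorem corr_ne_zero (B : V7) : corr B ≠ 0 := by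
  obtain ⟨h1, h2, h3, h4, h5, h6, h7⟩ := gens_ne_zero
  unfold corr
  exact mul_ne_zero (mul_ne_zero (mul_ne_zero (mul_ne_zero (mul_ne_zero (mul_ne_zero
    (pw_ne_zero h1 _) (pw_ne_zero h2 _)) (pw_ne_zero h3 _)) (pw_ne_zero h4 _)) (pw_ne_zero h5 _))
    (pw_ne_zero h6 _)) (pw_ne_zero h7 _)

/-- **A bit additive on products, on `z · ∏ gⱼ^{nⱼ}`**: `f z + Σ nⱼ f gⱼ`. [folklore] -/
theorem bitlike_mul_corr (f : K → ZMod 2) (hf : ∀ {z w : K}, z ≠ 0 → w ≠ 0 → f (z * w) = f z + f w)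
    {z : K} (hz : z ≠ 0) (B : V7) :
    f (z * corr B) = f z + ((ex B).1 * f (-1) + (ex B).2.1 * f εK + (ex B).2.2.1 * f π₂K +
      (ex B).2.2.2.1 * f 2 + (ex B).2.2.2.2.1 * f 3 + (ex B).2.2.2.2.2.1 * f π₃K +
      (ex B).2.2.2.2.2.2 * f 5) := by
  obtain ⟨h1, h2, h3, h4, h5, h6, h7⟩ := gens_ne_zero
  have hf1 : f 1 = 0 := by
    have h := hf (one_ne_zero (α := K)) one_ne_zero
    rw [mul_one] at h
    have : f 1 + f 1 = 0 := CharTwo.add_self_eq_zero _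
    rwa [← h] at this
  have hpw : ∀ (g : K) (e : ZMod 2), f (pw g e) = e * f g := by
    intro g e
    unfold pw
    rcases (show e = 0 ∨ e = 1 by revert e; decide) with rfl | rfl
    · rw [if_pos rfl, zero_mul, hf1]
    · rw [if_neg (by decide), one_mul]
  unfold corr
  have p1 := pw_ne_zero h1 (ex B).1
  have p2 := pw_ne_zero h2 (ex B).2.1
  have p3 := pw_ne_zero h3 (ex B).2.2.1
  have p4 := pw_ne_zero h4 (ex B).2.2.2.1
  have p5 := pw_ne_zero h5 (ex B).2.2.2.2.1
  have p6 := pw_ne_zero h6 (ex B).2.2.2.2.2.1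
  have p7 := pw_ne_zero h7 (ex B).2.2.2.2.2.2
  rw [show z * (pw (-1) (ex B).1 * pw εK (ex B).2.1 * pw π₂K (ex B).2.2.1 * pw 2 (ex B).2.2.2.1 *
      pw 3 (ex B).2.2.2.2.1 * pw π₃K (ex B).2.2.2.2.2.1 * pw 5 (ex B).2.2.2.2.2.2) =
      z * pw (-1) (ex B).1 * pw εK (ex B).2.1 * pw π₂K (ex B).2.2.1 * pw 2 (ex B).2.2.2.1 *
      pw 3 (ex B).2.2.2.2.1 * pw π₃K (ex B).2.2.2.2.2.1 * pw 5 (ex B).2.2.2.2.2.2 by ring,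
    hf (mul_ne_zero (mul_ne_zero (mul_ne_zero (mul_ne_zero (mul_ne_zero (mul_ne_zero hz p1) p2) p3)
      p4) p5) p6) p7,
    hf (mul_ne_zero (mul_ne_zero (mul_ne_zero (mul_ne_zero (mul_ne_zero hz p1) p2) p3) p4) p5) p6,
    hf (mul_ne_zero (mul_ne_zero (mul_ne_zero (mul_ne_zero hz p1) p2) p3) p4) p5,
    hf (mul_ne_zero (mul_ne_zero (mul_ne_zero hz p1) p2) p3) p4,
    hf (mul_ne_zero (mul_ne_zero hz p1) p2) p3, hf (mul_ne_zero hz p1) p2, hf hz p1,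
    hpw, hpw, hpw, hpw, hpw, hpw, hpw]
  ring

/-- The bits of `z · ∏ gⱼ^{nⱼ}`. [folklore] -/
theorem Bits_mul_corr {z : K} (hz : z ≠ 0) (B : V7) :
    Bits (z * corr B) = Bits z + ((ex B).1 • Bits (-1 : K) + (ex B).2.1 • Bits εK +
      (ex B).2.2.1 • Bits π₂K + (ex B).2.2.2.1 • Bits (2 : K) + (ex B).2.2.2.2.1 • Bits (3 : K) +
      (ex B).2.2.2.2.2.1 • Bits π₃K + (ex B).2.2.2.2.2.2 • Bits (5 : K)) := by
  obtain ⟨h1, h2, h3, h4, h5, h6, h7⟩ := gens_ne_zero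
  unfold corr
  have p1 := pw_ne_zero h1 (ex B).1
  have p2 := pw_ne_zero h2 (ex B).2.1
  have p3 := pw_ne_zero h3 (ex B).2.2.1
  have p4 := pw_ne_zero h4 (ex B).2.2.2.1
  have p5 := pw_ne_zero h5 (ex B).2.2.2.2.1
  have p6 := pw_ne_zero h6 (ex B).2.2.2.2.2.1
  have p7 := pw_ne_zero h7 (ex B).2.2.2.2.2.2
  rw [show z * (pw (-1) (ex B).1 * pw εK (ex B).2.1 * pw π₂K (ex B).2.2.1 * pw 2 (ex B).2.2.2.1 *
      pw 3 (ex B).2.2.2.2.1 * pw π₃K (ex B).2.2.2.2.2.1 * pw 5 (ex B).2.2.2.2.2.2) =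
      z * pw (-1) (ex B).1 * pw εK (ex B).2.1 * pw π₂K (ex B).2.2.1 * pw 2 (ex B).2.2.2.1 *
      pw 3 (ex B).2.2.2.2.1 * pw π₃K (ex B).2.2.2.2.2.1 * pw 5 (ex B).2.2.2.2.2.2 by ring,
    Bits_mul (mul_ne_zero (mul_ne_zero (mul_ne_zero (mul_ne_zero (mul_ne_zero (mul_ne_zero hz p1) p2) p3)
      p4) p5) p6) p7,
    Bits_mul (mul_ne_zero (mul_ne_zero (mul_ne_zero (mul_ne_zero (mul_ne_zero hz p1) p2) p3) p4) p5) p6,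
    Bits_mul (mul_ne_zero (mul_ne_zero (mul_ne_zero (mul_ne_zero hz p1) p2) p3) p4) p5,
    Bits_mul (mul_ne_zero (mul_ne_zero (mul_ne_zero hz p1) p2) p3) p4,
    Bits_mul (mul_ne_zero (mul_ne_zero hz p1) p2) p3, Bits_mul (mul_ne_zero hz p1) p2, Bits_mul hz p1,
    Bits_pw, Bits_pw, Bits_pw, Bits_pw, Bits_pw, Bits_pw, Bits_pw]
  abel

set_option maxRecDepth 100000 in
/-- The exponents invert the bit table: `B + Σⱼ nⱼ(B) Bits(gⱼ) = 0` for all `B ∈ 𝔽₂⁷`. [folklore] -/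
theorem ex_key : ∀ B : V7, B + ((ex B).1 • ((1, 1, 0, 0, 0, 0, 0) : V7) +
    (ex B).2.1 • ((0, 1, 0, 0, 0, 0, 0) : V7) + (ex B).2.2.1 • ((0, 0, 0, 1, 0, 0, 0) : V7) +
    (ex B).2.2.2.1 • ((0, 0, 1, 1, 0, 0, 0) : V7) + (ex B).2.2.2.2.1 • ((0, 0, 0, 0, 0, 1, 1) : V7) +
    (ex B).2.2.2.2.2.1 • ((0, 1, 0, 0, 0, 0, 1) : V7) + (ex B).2.2.2.2.2.2 • ((0, 0, 0, 0, 1, 0, 0) : V7)) = 0 := by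
  decide

/-- **All structural bits of `z · ∏ gⱼ^{nⱼ(Bits z)}` vanish.** [folklore] -/
theorem Bits_mul_corr_eq_zero {z : K} (hz : z ≠ 0) : Bits (z * corr (Bits z)) = 0 := by
  obtain ⟨b1, b2, b3, b4, b5, b6, b7⟩ := Bits_values
  rw [Bits_mul_corr hz, b1, b2, b3, b4, b5, b6, b7]
  exact ex_key (Bits z)

/-! ### Valuations of the basis outside `S` -/

/-- If `r s = 30` in `𝓞 K` and `30 ∉ v`, then `ord_v(r) = 0`. [folklore] -/
theorem valuation_eq_one_of_mul_eq {r t : 𝓞 K} (h : r * t = 30) (v : HeightOneSpectrum (𝓞 K))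
    (hv : (30 : 𝓞 K) ∉ v.asIdeal) : v.valuation K (r : K) = 1 := by
  have h30 : v.intValuation (30 : 𝓞 K) = 1 := intValuation_eq_one_iff.mpr hv
  rw [← h, map_mul] at h30
  have hr := v.intValuation_le_one r
  have ht := v.intValuation_le_one t
  rw [RingOfIntegers.coe_eq_algebraMap, valuation_of_algebraMap]
  by_contra hne
  have hlt : v.intValuation r < 1 := lt_of_le_of_ne hr hne
  have : v.intValuation r * v.intValuation t < 1 := by
    calc v.intValuation r * v.intValuation t ≤ v.intValuation r * 1 := by gcongr
      _ < 1 := by rwa [mul_one]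
  exact absurd h30 this.ne

/-- **The basis elements are units outside `S`**: `ord_v(g) = 0` for `30 ∉ v`. [folklore] -/
theorem valuation_gens (v : HeightOneSpectrum (𝓞 K)) (hv : (30 : 𝓞 K) ∉ v.asIdeal) :
    v.valuation K (-1) = 1 ∧ v.valuation K εK = 1 ∧ v.valuation K π₂K = 1 ∧ v.valuation K 2 = 1 ∧
    v.valuation K 3 = 1 ∧ v.valuation K π₃K = 1 ∧ v.valuation K 5 = 1 := by
  refine ⟨by rw [Valuation.map_neg, Valuation.map_one], ?_, ?_, ?_, ?_, ?_, ?_⟩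
  · rw [εK_eq, RingOfIntegers.coe_eq_algebraMap, valuation_of_algebraMap]
    exact intValuation_eq_one_iff.mpr fun h =>
      v.isPrime.ne_top (Ideal.eq_top_of_isUnit_mem _ h (Units.isUnit unitEps))
  · rw [π₂K_eq]
    exact valuation_eq_one_of_mul_eq (t := π₂' * 15) (by rw [← mul_assoc, π₂_mul_π₂']; norm_num) v hv
  · have := valuation_eq_one_of_mul_eq (r := 2) (t := 15) (by norm_num) v hv
    simpa [map_ofNat] using this
  · have := valuation_eq_one_of_mul_eq (r := 3) (t := 10) (by norm_num) v hv
    simpa [map_ofNat] using this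
  · rw [π₃K_eq]
    exact valuation_eq_one_of_mul_eq (t := π₃'' * 10) (by rw [← mul_assoc, π₃_mul_π₃'']; norm_num) v hv
  · have := valuation_eq_one_of_mul_eq (r := 5) (t := 6) (by norm_num) v hv
    simpa [map_ofNat] using this

/-- `ord_v(pw g e)` is trivial outside `S`. [folklore] -/
theorem valuation_pw {g : K} {v : HeightOneSpectrum (𝓞 K)} (hg : v.valuation K g = 1) (e : ZMod 2) :
    v.valuation K (pw g e) = 1 := by
  unfold pw; split_ifs
  · exact Valuation.map_one _
  · exact hg

/-- `ord_v(∏ gⱼ^{nⱼ}) = 0` outside `S`. [folklore] -/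
theorem valuation_corr (B : V7) (v : HeightOneSpectrum (𝓞 K)) (hv : (30 : 𝓞 K) ∉ v.asIdeal) :
    v.valuation K (corr B) = 1 := by
  obtain ⟨g1, g2, g3, g4, g5, g6, g7⟩ := valuation_gens v hv
  unfold corr
  simp only [Valuation.map_mul, valuation_pw g1, valuation_pw g2, valuation_pw g3, valuation_pw g4,
    valuation_pw g5, valuation_pw g6, valuation_pw g7, mul_one]

/-! ### The character sum -/

/-- **`z · ∏ gⱼ^{nⱼ(Bits z)}` is a square** for `z ∈ Kˣ` with even valuation outside `S`: all its
structural bits vanish (`Bits_mul_corr_eq_zero`), so the square theorem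
`Sqrt73.exists_sq_eq_of_local_data` applies. This is `K(S, 2) ≅ 𝔽₂⁷` with basis
`-1, ε, π₂, 2, 3, π₃, 5`. [cite: SilvermanAEC2009, Prop. VIII.1.6] -/
theorem exists_sq_eq_mul_corr {z : K} (hz : z ≠ 0)
    (hS : ∀ v : HeightOneSpectrum (𝓞 K), (30 : 𝓞 K) ∉ v.asIdeal → (2 : ℤ) ∣ log (v.valuation K z)) :
    ∃ w : K, z * corr (Bits z) = w ^ 2 := by
  set z' := z * corr (Bits z) with hz'
  have hz'0 : z' ≠ 0 := mul_ne_zero hz (corr_ne_zero _)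
  have hB := Bits_mul_corr_eq_zero hz
  rw [← hz'] at hB
  simp only [Bits, Prod.mk_eq_zero] at hB
  obtain ⟨hs1, hs2, ha1, ha2, ha5', hc1, hc2⟩ := hB
  have hev : ∀ {n : ℤ}, (n : ZMod 2) = 0 → Even n := fun h =>
    even_iff_two_dvd.mpr ((ZMod.intCast_zmod_eq_zero_iff_dvd _ 2).mp h)
  refine exists_sq_eq_of_local_data hz'0 (fun v hv => ?_) (hev ha1) (hev ha2) (hev hc1) (hev hc2) ?_
    ((rsign_eq_zero_iff ((map_ne_zero σpos).mpr hz'0)).mp hs1)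
    ((rsign_eq_zero_iff ((map_ne_zero σneg).mpr hz'0)).mp hs2)
  · have hvz : v.valuation K z ≠ 0 := (Valuation.ne_zero_iff _).mpr hz
    have hvc : v.valuation K (corr (Bits z)) ≠ 0 := (Valuation.ne_zero_iff _).mpr (corr_ne_zero _)
    rw [hz', Valuation.map_mul, log_mul hvz hvc, valuation_corr _ v hv, log_one, add_zero]
    exact hS v hv
  · have h4 := (inertPlace_parity_eq_zero_iff 5 73 inert_five_data.1 inert_five_data.2 hz'0).mp ha5'
    rwa [algNorm_eq_norm]

/-- The value of a character of `Kˣ/Kˣ²` on (the class of) an element. [folklore] -/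
def cv (c : Additive (SqUnits K) →+ ZMod 2) (z : K) : ZMod 2 := c (Additive.ofMul (sqClass z))

/-- `cv c` is additive on products of non-zero elements. [folklore] -/
theorem cv_mul (c : Additive (SqUnits K) →+ ZMod 2) {z w : K} (hz : z ≠ 0) (hw : w ≠ 0) :
    cv c (z * w) = cv c z + cv c w := by
  rw [cv, cv, cv, sqClass_mul hz hw, ofMul_mul, map_add]

/-- `cv c` kills squares. [folklore] -/
theorem cv_sq (c : Additive (SqUnits K) →+ ZMod 2) (w : K) : cv c (w ^ 2) = 0 := by
  rw [cv, sqClass_sq, ofMul_one, map_zero]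

/-- **The character sum for `K = ℚ(√73)`, `S = {∞±, 2±, 3±, 5}`.** For every character `c` of
`Kˣ/Kˣ²` and every `z ∈ Kˣ` with even valuation at all primes not above `30`:
`c[z] = n₁ c[-1] + n₂ c[ε] + n₃ c[π₂] + n₄ c[2] + n₅ c[3] + n₆ c[π₃] + n₇ c[5]` with
`(n₁, …, n₇) = ex (Bits z)` — the analogue over `K` of the tree's `char_sqClass_eq_sum` over `ℚ`
(unique factorisation being replaced by `h_K = 1` and the unit theorem).
[cite: SilvermanAEC2009, Prop. VIII.1.6] -/
theorem char_eq_sum (c : Additive (SqUnits K) →+ ZMod 2) {z : K} (hz : z ≠ 0)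
    (hS : ∀ v : HeightOneSpectrum (𝓞 K), (30 : 𝓞 K) ∉ v.asIdeal → (2 : ℤ) ∣ log (v.valuation K z)) :
    cv c z = (ex (Bits z)).1 * cv c (-1) + (ex (Bits z)).2.1 * cv c εK + (ex (Bits z)).2.2.1 * cv c π₂K +
      (ex (Bits z)).2.2.2.1 * cv c 2 + (ex (Bits z)).2.2.2.2.1 * cv c 3 +
      (ex (Bits z)).2.2.2.2.2.1 * cv c π₃K + (ex (Bits z)).2.2.2.2.2.2 * cv c 5 := by
  obtain ⟨w, hw⟩ := exists_sq_eq_mul_corr hz hS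
  have h := bitlike_mul_corr (cv c) (fun hz hw => cv_mul c hz hw) hz (Bits z)
  rw [hw, cv_sq] at h
  have key : ∀ a b : ZMod 2, 0 = a + b → a = b := by decide
  exact key _ _ h

/-! ### The seven local characters and their values on the basis -/

/-- `c4⁺ = chi4 ∘ ι⁺` (odd part of `ι⁺ z` is `3 mod 4`). [folklore] -/
def c4P (z : K) : ZMod 2 := pc4 (ιpos z)
/-- `c8⁺ = chi8 ∘ ι⁺`. [folklore] -/
def c8P (z : K) : ZMod 2 := pc8 (ιpos z)
/-- `c4⁻ = chi4 ∘ ι⁻`. [folklore] -/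
def c4N (z : K) : ZMod 2 := pc4 (ιneg z)
/-- `c8⁻ = chi8 ∘ ι⁻`. [folklore] -/
def c8N (z : K) : ZMod 2 := pc8 (ιneg z)
/-- `x₅`: the quadratic character of the residue field `𝔽₂₅` at `(5)`, via the norm. [folklore] -/
def x5 (z : K) : ZMod 2 := 𝔳5.χ z
/-- `q⁺`: the Legendre bit mod `3` under `κ⁺` (the place `𝔭₃''`). [folklore] -/
def qP (z : K) : ZMod 2 := pχ 3 (κpos z)
/-- `q⁻`: the Legendre bit mod `3` under `κ⁻` (the place `𝔭₃`). [folklore] -/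
def qN (z : K) : ZMod 2 := pχ 3 (κneg z)

/-- Unfolding `x5`: `qrBit 5 (N z)`. [folklore] -/
theorem x5_eq (z : K) : x5 z = qrBit 5 z.norm := rfl

/-- The seven local characters are additive on products. [folklore] -/
theorem chars_mul {z w : K} (hz : z ≠ 0) (hw : w ≠ 0) :
    c4P (z * w) = c4P z + c4P w ∧ c8P (z * w) = c8P z + c8P w ∧ c4N (z * w) = c4N z + c4N w ∧
    c8N (z * w) = c8N z + c8N w ∧ x5 (z * w) = x5 z + x5 w ∧ qP (z * w) = qP z + qP w ∧
    qN (z * w) = qN z + qN w := by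
  have i1 := (map_ne_zero ιpos).mpr hz; have i2 := (map_ne_zero ιpos).mpr hw
  have j1 := (map_ne_zero ιneg).mpr hz; have j2 := (map_ne_zero ιneg).mpr hw
  have k1 := (map_ne_zero κpos).mpr hz; have k2 := (map_ne_zero κpos).mpr hw
  have l1 := (map_ne_zero κneg).mpr hz; have l2 := (map_ne_zero κneg).mpr hw
  refine ⟨?_, ?_, ?_, ?_, 𝔳5.χ_mul hz hw, ?_, ?_⟩
  · rw [c4P, c4P, c4P, map_mul, pc4_mul i1 i2]
  · rw [c8P, c8P, c8P, map_mul, pc8_mul i1 i2]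
  · rw [c4N, c4N, c4N, map_mul, pc4_mul j1 j2]
  · rw [c8N, c8N, c8N, map_mul, pc8_mul j1 j2]
  · rw [qP, qP, qP, map_mul, pχ_mul 3 k1 k2]
  · rw [qN, qN, qN, map_mul, pχ_mul 3 l1 l2]

/-- **The row of local character values** `(c4⁺, c8⁺, c4⁻, c8⁻, x₅, q⁺, q⁻)` of `z`. [folklore] -/
def Row (z : K) : V7 := (c4P z, c8P z, c4N z, c8N z, x5 z, qP z, qN z)

/-- `pχ 3 t = 1` if the residue is a non-square. [folklore] -/
theorem pχ_three_eq_one_of_not_isSquare {t : ℚ_[3]} (h : ¬ IsSquare (pres 3 t)) : pχ 3 t = 1 := by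
  have hne : pχ 3 t ≠ 0 := fun h0 => h ((pχ_eq_zero_iff 3 t).mp h0)
  revert hne; generalize pχ 3 t = b; revert b; decide

/-- `pχ 3 t = 0` if the residue is a square. [folklore] -/
theorem pχ_three_eq_zero_of_isSquare {t : ℚ_[3]} (h : IsSquare (pres 3 t)) : pχ 3 t = 0 :=
  (pχ_eq_zero_iff 3 t).mpr h

/-- Squares and non-squares in `𝔽₃` among the residues met. [folklore] -/
theorem isSquare_three :
    ¬ IsSquare ((1193 : ℤ) : ZMod 3) ∧ IsSquare ((943 : ℤ) : ZMod 3) ∧ IsSquare ((10 : ℤ) : ZMod 3) ∧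
    ¬ IsSquare ((8 : ℤ) : ZMod 3) ∧ IsSquare ((19 : ℤ) : ZMod 3) ∧ ¬ IsSquare ((5 : ℤ) : ZMod 3) := by
  obtain ⟨n2, -, -, -, s1, -⟩ := isSquare_values
  refine ⟨?_, ?_, ?_, ?_, ?_, ?_⟩
  · rw [show ((1193 : ℤ) : ZMod 3) = 2 by decide]; exact n2
  · rw [show ((943 : ℤ) : ZMod 3) = 1 by decide]; exact s1
  · rw [show ((10 : ℤ) : ZMod 3) = 1 by decide]; exact s1
  · rw [show ((8 : ℤ) : ZMod 3) = 2 by decide]; exact n2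
  · rw [show ((19 : ℤ) : ZMod 3) = 1 by decide]; exact s1
  · rw [show ((5 : ℤ) : ZMod 3) = 2 by decide]; exact n2

/-- The `2`-adic characters on the rational basis elements `-1, 2, 3, 5` (tree tables). [folklore] -/
theorem c_values_rat :
    (c4P (-1 : K) = 1 ∧ c8P (-1 : K) = 0 ∧ c4N (-1 : K) = 1 ∧ c8N (-1 : K) = 0) ∧
    (c4P (2 : K) = 0 ∧ c8P (2 : K) = 0 ∧ c4N (2 : K) = 0 ∧ c8N (2 : K) = 0) ∧
    (c4P (3 : K) = 1 ∧ c8P (3 : K) = 1 ∧ c4N (3 : K) = 1 ∧ c8N (3 : K) = 1) ∧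
    (c4P (5 : K) = 0 ∧ c8P (5 : K) = 1 ∧ c4N (5 : K) = 0 ∧ c8N (5 : K) = 1) := by
  obtain ⟨f1, f2, f3, f5, -, -⟩ := chi4_values
  obtain ⟨e1, e2, e3, e5, -, -⟩ := chi8_values
  have hm : ∀ (τ : K →ₐ[ℚ] ℚ_[2]), τ (-1 : K) = ((-1 : ℚ) : ℚ_[2]) ∧ τ (2 : K) = ((2 : ℚ) : ℚ_[2]) ∧
      τ (3 : K) = ((3 : ℚ) : ℚ_[2]) ∧ τ (5 : K) = ((5 : ℚ) : ℚ_[2]) := fun τ =>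
    ⟨by rw [map_neg, map_one]; norm_num, by rw [map_ofNat]; norm_num, by rw [map_ofNat]; norm_num,
      by rw [map_ofNat]; norm_num⟩
  obtain ⟨p1, p2, p3, p5⟩ := hm ιpos
  obtain ⟨n1, n2, n3, n5⟩ := hm ιneg
  simp only [c4P, c8P, c4N, c8N, p1, p2, p3, p5, n1, n2, n3, n5, pc4_ratCast, pc8_ratCast, f1, f2, f3, f5,
    e1, e2, e3, e5, and_self]

/-- The `3`-adic characters on the rational basis elements (tree tables). [folklore] -/
theorem q_values_rat :
    (qP (-1 : K) = 1 ∧ qN (-1 : K) = 1) ∧ (qP (2 : K) = 1 ∧ qN (2 : K) = 1) ∧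
    (qP (3 : K) = 0 ∧ qN (3 : K) = 0) ∧ (qP (5 : K) = 1 ∧ qN (5 : K) = 1) := by
  obtain ⟨g1, g2, g3, g5, -, -⟩ := qrBit_three_values
  have hm : ∀ (τ : K →ₐ[ℚ] ℚ_[3]), τ (-1 : K) = ((-1 : ℚ) : ℚ_[3]) ∧ τ (2 : K) = ((2 : ℚ) : ℚ_[3]) ∧
      τ (3 : K) = ((3 : ℚ) : ℚ_[3]) ∧ τ (5 : K) = ((5 : ℚ) : ℚ_[3]) := fun τ =>
    ⟨by rw [map_neg, map_one]; norm_num, by rw [map_ofNat]; norm_num, by rw [map_ofNat]; norm_num,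
      by rw [map_ofNat]; norm_num⟩
  obtain ⟨p1, p2, p3, p5⟩ := hm κpos
  obtain ⟨n1, n2, n3, n5⟩ := hm κneg
  simp only [qP, qN, p1, p2, p3, p5, n1, n2, n3, n5, pχ_ratCast, g1, g2, g3, g5, and_self]

/-- `x₅` on the basis: `1` on `π₂`, `π₃` (norms `2`, `-3` are non-squares mod `5`), else `0`.
[folklore] -/
theorem x5_values : x5 (-1 : K) = 0 ∧ x5 εK = 0 ∧ x5 π₂K = 1 ∧ x5 (2 : K) = 0 ∧ x5 (3 : K) = 0 ∧
    x5 π₃K = 1 ∧ x5 (5 : K) = 0 := by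
  obtain ⟨n1, n2, n3, n4, n5, n6, n7⟩ := norm_values
  obtain ⟨t1, t2, t3, t5, -, -⟩ := qrBit_five_values
  simp only [x5_eq, n1, n2, n3, n4, n5, n6, n7]
  refine ⟨?_, t1, t2, ?_, ?_, ?_, ?_⟩
  · rw [show (1 : ℚ) = 1 ^ 2 by norm_num, qrBit_sq]
  · rw [show (4 : ℚ) = 2 ^ 2 by norm_num, qrBit_sq]
  · rw [show (9 : ℚ) = 3 ^ 2 by norm_num, qrBit_sq]
  · rw [show (-3 : ℚ) = (-1) * 3 by norm_num, qrBit_mul 5 (by norm_num) (by norm_num), t1, t3]; decide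
  · rw [show (25 : ℚ) = 5 ^ 2 by norm_num, qrBit_sq]

/-- The `2`-adic characters on `ε, π₂, π₃`: residues `4693, -2557; 19, 2·(-5); 75, -41` mod `8`.
[folklore] -/
theorem c_values_irrat :
    (c4P εK = 0 ∧ c8P εK = 1 ∧ c4N εK = 1 ∧ c8N εK = 1) ∧
    (c4P π₂K = 1 ∧ c8P π₂K = 1 ∧ c4N π₂K = 1 ∧ c8N π₂K = 1) ∧
    (c4P π₃K = 1 ∧ c8P π₃K = 1 ∧ c4N π₃K = 1 ∧ c8N π₃K = 0) := by
  obtain ⟨t, ht⟩ := exists_sqrt73Two_eq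
  obtain ⟨e1, e2, e3, e4, e5, e6⟩ := ι_values ht
  obtain ⟨a1, b1⟩ := pc48_intCast_add_mul (n := 4693) (m := 8000) (by decide) (by decide) t
  obtain ⟨a2, b2⟩ := pc48_intCast_add_mul (n := -2557) (m := -8000) (by decide) (by decide) t
  obtain ⟨a3, b3⟩ := pc48_intCast_add_mul (n := 19) (m := 32) (by decide) (by decide) t
  obtain ⟨a4, b4⟩ := pc48_intCast_add_mul (n := -5) (m := -16) (by decide) (by decide) t
  obtain ⟨a5', b5⟩ := pc48_intCast_add_mul (n := 75) (m := 128) (by decide) (by decide) t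
  obtain ⟨a6, b6⟩ := pc48_intCast_add_mul (n := -41) (m := -128) (by decide) (by decide) t
  have hu := (valuation_intCast_add_mul (p := 2) (n := -5) (m := -16) (by decide) (by decide) t).1
  have h2 : pc4 (2 : ℚ_[2]) = 0 ∧ pc8 (2 : ℚ_[2]) = 0 := by
    rw [show (2 : ℚ_[2]) = ((2 : ℚ) : ℚ_[2]) by norm_num, pc4_ratCast, pc8_ratCast]
    exact ⟨chi4_values.2.1, chi8_values.2.1⟩
  refine ⟨⟨?_, ?_, ?_, ?_⟩, ⟨?_, ?_, ?_, ?_⟩, ⟨?_, ?_, ?_, ?_⟩⟩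
  · rw [c4P, e1, a1]; decide
  · rw [c8P, e1, b1]; decide
  · rw [c4N, e2, a2]; decide
  · rw [c8N, e2, b2]; decide
  · rw [c4P, e3, a3]; decide
  · rw [c8P, e3, b3]; decide
  · rw [c4N, e4, pc4_mul two_ne_zero hu, h2.1, a4]; decide
  · rw [c8N, e4, pc8_mul two_ne_zero hu, h2.2, b4]; decide
  · rw [c4P, e5, a5']; decide
  · rw [c8P, e5, b5]; decide
  · rw [c4N, e6, a6]; decide
  · rw [c8N, e6, b6]; decide

/-- The `3`-adic characters on `ε, π₂, π₃`: residues `1193, 943; 2⁻¹·10, 2⁻¹·8; 19, 3·5`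
mod `3`. [folklore] -/
theorem q_values_irrat :
    (qP εK = 1 ∧ qN εK = 0) ∧ (qP π₂K = 1 ∧ qN π₂K = 0) ∧ (qP π₃K = 0 ∧ qN π₃K = 1) := by
  obtain ⟨t, ht⟩ := exists_sqrt73Three_eq
  obtain ⟨e1, e2, e3, e4, e5, e6⟩ := κ_values ht
  obtain ⟨s1, s2, s3, s4, s5, s6⟩ := isSquare_three
  have r1 := pres_intCast_add_mul (p := 3) (n := 1193) (m := 1125) (by decide) (by decide) t
  have r2 := pres_intCast_add_mul (p := 3) (n := 943) (m := -1125) (by decide) (by decide) t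
  have r3 := pres_intCast_add_mul (p := 3) (n := 10) (m := 9) (by decide) (by decide) t
  have r4 := pres_intCast_add_mul (p := 3) (n := 8) (m := -9) (by decide) (by decide) t
  have r5 := pres_intCast_add_mul (p := 3) (n := 19) (m := 18) (by decide) (by decide) t
  have r6 := pres_intCast_add_mul (p := 3) (n := 5) (m := -6) (by decide) (by decide) t
  have u3 := (valuation_intCast_add_mul (p := 3) (n := 10) (m := 9) (by decide) (by decide) t).1
  have u4 := (valuation_intCast_add_mul (p := 3) (n := 8) (m := -9) (by decide) (by decide) t).1
  have u6 := (valuation_intCast_add_mul (p := 3) (n := 5) (m := -6) (by decide) (by decide) t).1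
  have h2 : pχ 3 (2 : ℚ_[3])⁻¹ = 1 := by
    have := (padicPlace 3).χ_inv (two_ne_zero (α := ℚ_[3]))
    rw [padicPlace_χ, padicPlace_χ] at this
    rw [this, show (2 : ℚ_[3]) = ((2 : ℚ) : ℚ_[3]) by norm_num, pχ_ratCast]
    exact qrBit_three_values.2.1
  have h3 : pχ 3 (3 : ℚ_[3]) = 0 := by
    rw [show (3 : ℚ_[3]) = ((3 : ℚ) : ℚ_[3]) by norm_num, pχ_ratCast]
    exact qrBit_three_values.2.2.1
  refine ⟨⟨?_, ?_⟩, ⟨?_, ?_⟩, ⟨?_, ?_⟩⟩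
  · rw [qP, e1]; exact pχ_three_eq_one_of_not_isSquare (by rw [r1]; exact s1)
  · rw [qN, e2]; exact pχ_three_eq_zero_of_isSquare (by rw [r2]; exact s2)
  · rw [qP, e3, pχ_mul 3 (inv_ne_zero two_ne_zero) u3, h2, pχ_three_eq_zero_of_isSquare (by rw [r3]; exact s3)]
    decide
  · rw [qN, e4, pχ_mul 3 (inv_ne_zero two_ne_zero) u4, h2,
      pχ_three_eq_one_of_not_isSquare (by rw [r4]; exact s4)]
    decide
  · rw [qP, e5]; exact pχ_three_eq_zero_of_isSquare (by rw [r5]; exact s5)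
  · rw [qN, e6, pχ_mul 3 (by norm_num) u6, h3, pχ_three_eq_one_of_not_isSquare (by rw [r6]; exact s6)]
    decide

/-- **The table of local character values on the basis of `K(S, 2)`** (rows
`(c4⁺, c8⁺, c4⁻, c8⁻, x₅, q⁺, q⁻)`). [folklore] -/
theorem Row_values :
    Row (-1 : K) = (1, 0, 1, 0, 0, 1, 1) ∧ Row εK = (0, 1, 1, 1, 0, 1, 0) ∧
    Row π₂K = (1, 1, 1, 1, 1, 1, 0) ∧ Row (2 : K) = (0, 0, 0, 0, 0, 1, 1) ∧
    Row (3 : K) = (1, 1, 1, 1, 0, 0, 0) ∧ Row π₃K = (1, 1, 1, 0, 1, 0, 1) ∧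
    Row (5 : K) = (0, 1, 0, 1, 0, 1, 1) := by
  obtain ⟨⟨a1, a2, a3, a4⟩, ⟨b1, b2, b3, b4⟩, ⟨d1, d2, d3, d4⟩, ⟨f1, f2, f3, f4⟩⟩ := c_values_rat
  obtain ⟨⟨g1, g2⟩, ⟨g3, g4⟩, ⟨g5, g6⟩, ⟨g7, g8⟩⟩ := q_values_rat
  obtain ⟨x1, x2, x3', x4, x5', x6, x7⟩ := x5_values
  obtain ⟨⟨h1, h2, h3, h4⟩, ⟨i1, i2, i3, i4⟩, ⟨j1, j2, j3, j4⟩⟩ := c_values_irrat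
  obtain ⟨⟨k1, k2⟩, ⟨k3, k4⟩, ⟨k5, k6⟩⟩ := q_values_irrat
  simp only [Row, a1, a2, a3, a4, b1, b2, b3, b4, d1, d2, d3, d4, f1, f2, f3, f4, g1, g2, g3, g4, g5, g6,
    g7, g8, x1, x2, x3', x4, x5', x6, x7, h1, h2, h3, h4, i1, i2, i3, i4, j1, j2, j3, j4, k1, k2, k3, k4,
    k5, k6, and_self]

/-- A local character as a homomorphism on `Kˣ/Kˣ²` and its character sum. For `f` one of the
seven local characters (each additive on products of non-zero elements), and `z ∈ Kˣ` with even
valuation outside `S`: `f z = Σⱼ nⱼ(Bits z) f(gⱼ)`. [cite: SilvermanAEC2009, Prop. VIII.1.6] -/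
theorem bit_eq_sum (f : K → ZMod 2) (hf : ∀ {z w : K}, z ≠ 0 → w ≠ 0 → f (z * w) = f z + f w)
    {z : K} (hz : z ≠ 0)
    (hS : ∀ v : HeightOneSpectrum (𝓞 K), (30 : 𝓞 K) ∉ v.asIdeal → (2 : ℤ) ∣ log (v.valuation K z)) :
    f z = (ex (Bits z)).1 * f (-1) + (ex (Bits z)).2.1 * f εK + (ex (Bits z)).2.2.1 * f π₂K +
      (ex (Bits z)).2.2.2.1 * f 2 + (ex (Bits z)).2.2.2.2.1 * f 3 +
      (ex (Bits z)).2.2.2.2.2.1 * f π₃K + (ex (Bits z)).2.2.2.2.2.2 * f 5 := by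
  have h := char_eq_sum (bitHom f (fun ha hb => hf ha hb)) hz hS
  obtain ⟨-, h2, h3, -, -, h6, -⟩ := gens_ne_zero
  simp only [cv, bitHom_sqClass _ _ hz, bitHom_sqClass _ _ (show (-1 : K) ≠ 0 by norm_num),
    bitHom_sqClass _ _ h2, bitHom_sqClass _ _ h3, bitHom_sqClass _ _ (show (2 : K) ≠ 0 by norm_num),
    bitHom_sqClass _ _ (show (3 : K) ≠ 0 by norm_num), bitHom_sqClass _ _ h6,
    bitHom_sqClass _ _ (show (5 : K) ≠ 0 by norm_num)] at h
  exact h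

/-- **The local characters in coordinates.** For `z ∈ Kˣ` with even valuation outside `S`,
`Row z` is the `𝔽₂`-linear image of `Bits z` through the exponents and the value table.
[folklore] -/
theorem Row_eq (z : K) (hz : z ≠ 0)
    (hS : ∀ v : HeightOneSpectrum (𝓞 K), (30 : 𝓞 K) ∉ v.asIdeal → (2 : ℤ) ∣ log (v.valuation K z)) :
    Row z = (ex (Bits z)).1 • ((1, 0, 1, 0, 0, 1, 1) : V7) + (ex (Bits z)).2.1 • ((0, 1, 1, 1, 0, 1, 0) : V7) +
      (ex (Bits z)).2.2.1 • ((1, 1, 1, 1, 1, 1, 0) : V7) + (ex (Bits z)).2.2.2.1 • ((0, 0, 0, 0, 0, 1, 1) : V7) +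
      (ex (Bits z)).2.2.2.2.1 • ((1, 1, 1, 1, 0, 0, 0) : V7) + (ex (Bits z)).2.2.2.2.2.1 • ((1, 1, 1, 0, 1, 0, 1) : V7) +
      (ex (Bits z)).2.2.2.2.2.2 • ((0, 1, 0, 1, 0, 1, 1) : V7) := by
  obtain ⟨r1, r2, r3, r4, r5, r6, r7⟩ := Row_values
  have m := fun {z w : K} (hz : z ≠ 0) (hw : w ≠ 0) => chars_mul hz hw
  have e1 := bit_eq_sum c4P (fun hz hw => (m hz hw).1) hz hS
  have e2 := bit_eq_sum c8P (fun hz hw => (m hz hw).2.1) hz hS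
  have e3 := bit_eq_sum c4N (fun hz hw => (m hz hw).2.2.1) hz hS
  have e4 := bit_eq_sum c8N (fun hz hw => (m hz hw).2.2.2.1) hz hS
  have e5 := bit_eq_sum x5 (fun hz hw => (m hz hw).2.2.2.2.1) hz hS
  have e6 := bit_eq_sum qP (fun hz hw => (m hz hw).2.2.2.2.2.1) hz hS
  have e7 := bit_eq_sum qN (fun hz hw => (m hz hw).2.2.2.2.2.2) hz hS
  simp only [Row, Prod.ext_iff] at r1 r2 r3 r4 r5 r6 r7
  obtain ⟨a1, a2, a3, a4, a5', a6, a7⟩ := r1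
  obtain ⟨b1, b2, b3, b4, b5, b6, b7⟩ := r2
  obtain ⟨d1, d2, d3, d4, d5, d6, d7⟩ := r3
  obtain ⟨f1, f2, f3, f4, f5, f6, f7⟩ := r4
  obtain ⟨g1, g2, g3, g4, g5, g6, g7⟩ := r5
  obtain ⟨h1, h2, h3, h4, h5, h6, h7⟩ := r6
  obtain ⟨i1, i2, i3, i4, i5, i6, i7⟩ := r7
  rw [a1, b1, d1, f1, g1, h1, i1] at e1
  rw [a2, b2, d2, f2, g2, h2, i2] at e2
  rw [a3, b3, d3, f3, g3, h3, i3] at e3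
  rw [a4, b4, d4, f4, g4, h4, i4] at e4
  rw [a5', b5, d5, f5, g5, h5, i5] at e5
  rw [a6, b6, d6, f6, g6, h6, i6] at e6
  rw [a7, b7, d7, f7, g7, h7, i7] at e7
  simp only [Row, e1, e2, e3, e4, e5, e6, e7, Prod.smul_mk, Prod.mk_add_mk, smul_eq_mul, mul_one,
    mul_zero, add_zero, zero_add]

end K73D

end DokchitserDokchitser2011

end Literature.Barriers.BirchSwinnertonDyer

end
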